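/-
# [B4] THEOREM (1.10), VALUE MEMBER, ON A BOX `Ω` — the walk route assembled on the lineage's box carriers
(R9 carrier bridge, file 5/5)

statement-level skeleton of published theorems with citation tags; proofs where landed; nothing here is a claim about
the Yang–Mills mass gap

[B4] = Balaban, *Regularity and decay of lattice Green's functions*, Commun. Math. Phys. 89 (1983) 571–597.

THEOREM p.573: «there exist positive constants δ₀, c₀ … such that |G_k(Ω,A;x,x′)| ≤ c₀ e^{−δ₀|x−x′|} (1.10) …
for A satisfying (1.7) with e sufficiently small».  §2 pp.575–579 proves it by the random-walk expansion (2.12) over the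
large cubes `□_j` (size `2M`, partition of unity `h_j` (2.5)), whose letters are controlled by Lemma 2.2 ((2.17)) and
the commutator estimate (2.20); the sum (2.13) converges once `3^d·(c₂O(1)M⁻¹) ≤ e^{−1}` ((2.21)–(2.22), «M
sufficiently large»).

The owner seat r01 proved the expansion and its summation ABSTRACTLY (`B4Ineq110WalkRoute.ineq110_value_apply`: any
finite site set with positions, any cube data `W′_j, T′_j, G_j` agreeing with the region's data on the plateaus, per-cube
inputs `‖G_j‖ ≤ γ`, `‖K_jG_jh_j‖ ≤ β`, `3^dβ ≤ e^{−1}`).  THIS FILE instantiates it on [B4]'s box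
`Ω = Box d ℓ k Mb ⊂ L^{-k}ℤ^{d+1}` with the lineage's operator `H = B4Lemma22ReduceZero.opA` ((1.6): bond weights
`boxWt`, block weights `blkWt`, running coefficient `a_kη^{d+1}`, staircase contours) and Green's function
`G_k(Ω,A) = greenA`, for an ARBITRARY bond configuration `A` and ARBITRARY cube configurations `Ã_j` agreeing with `A`
on the plateaus `{|x/n − Kj|_∞ ≤ ¾K}` (p.576 «A_j = A on {θ_j = 1}»):

* positions `posR x = x/n`, `M := K` (`8 ≤ K`, `4 ∣ K`), labels `labels Mb`, geometry from `B4BoxCubeGeometry`;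
* cube data = the FULL links and staircase transporters of `Ã_j` on `Ω` and `G_j := G_k(Ω, Ã_j)` (the cube predicate of the
  walk route taken to be all of `Ω` — the route only needs `□_j ⊇` the 7/8-box; this is the form in which p35's
  `B4Eq220CubeField.eq220_cubeField` / `lemma22_sup_cubeField` deliver the per-cube inputs at the print's `Ã_j`);
* the per-cube inputs in the lineage's `supN` form — `‖G_k(Ω,Ã_j)Φ‖_∞ ≤ c_G‖Φ‖_∞` ((2.17), `q = p = ∞`, `n = 0`) and
  `‖K_{h_j}G_k(Ω,Ã_j)h_jΦ‖_∞ ≤ c_K‖Φ‖_∞` ((2.20)) — converted to the walk route's `ℓ∞ → ℓ∞` operator norms by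
  `B4CubeOpReindex.linfty_opNorm_le_of_supN` (`‖T‖ ≤ √N·c`), and the smallness `3^{d+1}√N·c_K ≤ e^{−1}` ((2.21)–(2.22)).

MAIN THEOREM `thm110_value_box`: under these inputs, for every source `f` supported in a set at sup-distance `≥ D` (unit
lattice) from `x`, `|(G_k(Ω,A)f)(x)| ≤ 2^{d+2}e^{9/4}·√N c_G·e^{−D/K}·‖f‖_∞` — (1.10) with `δ₀ = 1/K`, `c₀ = 2^{d+2}e^{9/4}√N c_G`.
COROLLARY `thm110_value_box_cubeField`: the same for the lineage's component field `A = compField Ac` on `Ω` with the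
print's cube configurations `Ã_j = A(0) + θ_j(A − A(0))` (`B4CubeFields22.cubeField`, p35) — the plateau agreement is
p35's `cubeField_eq_compField`, so only the per-cube `supN` inputs remain, in the exact output form of
`B4Eq220CubeField.lemma22_sup_cubeField` / `eq220_cubeField` (interior cubes).

HONEST SCOPE.  Boxes `Ω` (print: «e.g. Ω is a rectangular parallelepiped», p.573); value member only (the derivative and
Hölder members (1.9), (1.12) have their own abstract routes `B4Ineq19WalkRoute`, not instantiated here); the per-cube
inputs are HYPOTHESES of the theorem in exactly the form the tree proves them (`B4Eq220CubeField` at interior cubes for a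
(1.7)-regular `A`, `B4Lemma22ReduceZero.const_box_sup` / `B4Eq220FactorField.eq220_hBox_sup_stair` at constant field) —
their discharge for a concrete regular `A` constant near `∂Ω` is the sequel.  No `Prop` fact, no `sorry`; axioms standard.
-/
import Literature.MathematicalPhysics.QuantumFieldTheory.Balaban1983to89.B4BoxCubeGeometry
import Literature.MathematicalPhysics.QuantumFieldTheory.Balaban1983to89.B4Eq220CommutatorField
import Literature.MathematicalPhysics.QuantumFieldTheory.Balaban1983to89.B4CubeFields22

namespace Literature.MathematicalPhysics.QuantumFieldTheory.Balaban1983to89.B4Thm110BoxWalk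

open Literature.MathematicalPhysics.QuantumFieldTheory.Balaban1983to89.B4Reflection242 (boxDom mem_boxDom nbrs blk)
open Literature.MathematicalPhysics.QuantumFieldTheory.Balaban1983to89.B4GaugeCovariance
open Literature.MathematicalPhysics.QuantumFieldTheory.Balaban1983to89.B4Commutators25to211 (mulH opK)
open Literature.MathematicalPhysics.QuantumFieldTheory.Balaban1983to89.B4Lower18Regular (baseEmb stairContour)
open Literature.MathematicalPhysics.QuantumFieldTheory.Balaban1983to89.B4Lemma22ReduceZero (Box opA greenA)
open Literature.MathematicalPhysics.QuantumFieldTheory.Balaban1983to89.B4Lemma22Reduce231 (supN)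
open Literature.MathematicalPhysics.QuantumFieldTheory.Balaban1983to89.B4Lemma22Invertible (opA_stair_isUnit_det)
open Literature.MathematicalPhysics.QuantumFieldTheory.Balaban1983to89.B4PartitionUnity22 (hCube)
open Literature.MathematicalPhysics.QuantumFieldTheory.Balaban1983to89.B4Eq220PartitionSizes (hBox)
open Literature.MathematicalPhysics.QuantumFieldTheory.Balaban1983to89.B4Eq220CommutatorField (kOp)
open Literature.MathematicalPhysics.QuantumFieldTheory.Balaban1983to89.B4Ineq110WalkRoute (ineq110_value_apply)
open Literature.MathematicalPhysics.QuantumFieldTheory.Balaban1983to89.B4CubeOpReindex (linfty_opNorm_le_of_supN)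
open Literature.MathematicalPhysics.QuantumFieldTheory.Balaban1983to89.B4BoxCubeGeometry
open Literature.MathematicalPhysics.QuantumFieldTheory.Balaban1983to89.B4Lower18RegularRegion (compField)
open Literature.MathematicalPhysics.QuantumFieldTheory.Balaban1983to89.B4CubeFields22 (cubeField cubeField_eq_compField)
open scoped Matrix
open scoped Matrix.Norms.Operator

noncomputable section

variable {d : ℕ}
variable {ι : Type} [Fintype ι] [DecidableEq ι]

/-! ## 1. The partition function of the walk route is [B4]'s own `h_j` -/

omit [Fintype ι] [DecidableEq ι] in
/-- the walk route's `h_j = hCube K j ∘ posR` is the lineage's concrete `h_j` on the box (`B4Eq220PartitionSizes.hBox`),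
definitionally. [cite: Balaban1983RegularityDecay, (2.5) p.575] -/
theorem hCube_posR_eq_hBox (ℓ k : ℕ) (Mb : Fin (d + 1) → ℕ) (K : ℕ) (j : Fin (d + 1) → ℤ) :
    (fun z : ↥(Box d ℓ k Mb) => hCube (K : ℝ) j (posR ℓ k Mb z)) = hBox ((ℓ + 1) ^ k) K Mb j := rfl

/-! ## 2. THEOREM (1.10), value member, on a box -/

/-- **THEOREM (1.10) ON A BOX `Ω`, VALUE MEMBER — THE WALK ROUTE ASSEMBLED** (pp.575–579 on the lineage's carriers).
Data: `Ω = Box d ℓ k Mb` (`L = ℓ+1 ≥ 2`, `k ≥ 1`, `n = L^k`), large-cube size `K` (`8 ≤ K`, `4 ∣ K`; the print's `M`),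
`a > 0`, `m² ≥ 0`, an arbitrary bond configuration `A` on `Ω` and cube configurations `Ã_j` (`j ∈ ℤ^{d+1}`) with
`Ã_j = A` on pairs of the plateau `{|x/n − Kj|_∞ ≤ ¾K}` (p.576).  Inputs, for every label `j ∈ labels Mb`:
`‖G_k(Ω,Ã_j)Φ‖_∞ ≤ c_G‖Φ‖_∞` (Lemma 2.2 (2.17)) and `‖K_{h_j}G_k(Ω,Ã_j)h_jΦ‖_∞ ≤ c_K‖Φ‖_∞` ((2.20)), and the smallness
`3^{d+1}·√N c_K ≤ e^{−1}` ((2.21)–(2.22) «M sufficiently large»).  Conclusion: for every fine site `x`, every set `P` of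
fine sites with `|x/n − x′/n|_∞ ≥ D` on `P`, every `N`-component source `f` supported in `P` with `|f| ≤ φ`:
`|(G_k(Ω,A)f)(x)| ≤ 2^{d+2}e^{9/4}·√N c_G·e^{−D/K}·φ`.
[cite: Balaban1983RegularityDecay, Theorem (1.10) p.573; (2.12)–(2.13) p.577, (2.21)–(2.22) pp.578–579] -/
theorem thm110_value_box (F : OrthFlow ι) (κ : ℝ) {ℓ k : ℕ} (hℓ : 1 ≤ ℓ) (hk : 1 ≤ k) (hn : 1 ≤ (ℓ + 1) ^ k)
    (Mb : Fin (d + 1) → ℕ) {K : ℕ} (hK8 : 8 ≤ K) (h4 : 4 ∣ K) {a m2 : ℝ} (ha : 0 < a) (hm : 0 ≤ m2)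
    (A : ↥(Box d ℓ k Mb) → ↥(Box d ℓ k Mb) → ℝ)
    (Ac : (Fin (d + 1) → ℤ) → ↥(Box d ℓ k Mb) → ↥(Box d ℓ k Mb) → ℝ)
    (hplat : ∀ j (u v : ↥(Box d ℓ k Mb)), (∀ μ, |posR ℓ k Mb u μ - (K : ℝ) * j μ| ≤ 3 / 4 * (K : ℝ)) →
      (∀ μ, |posR ℓ k Mb v μ - (K : ℝ) * j μ| ≤ 3 / 4 * (K : ℝ)) → Ac j u v = A u v)
    {cG cK : ℝ} (hcG : 0 ≤ cG) (hcK : 0 ≤ cK)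
    (hG : ∀ j ∈ labels Mb, ∀ Φ : ↥(Box d ℓ k Mb) × ι → ℝ,
      supN (greenA d F κ ℓ k a m2 Mb (baseEmb hn Mb) (stairContour hn Mb) (Ac j) *ᵥ Φ) ≤ cG * supN Φ)
    (hKG : ∀ j ∈ labels Mb, ∀ Φ : ↥(Box d ℓ k Mb) × ι → ℝ,
      supN (kOp F κ ((ℓ + 1) ^ k) (B1.aSeq a ((ℓ : ℝ) + 1) k) m2 Mb (baseEmb hn Mb) (stairContour hn Mb) (Ac j)
            (hBox ((ℓ + 1) ^ k) K Mb j)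
          *ᵥ (greenA d F κ ℓ k a m2 Mb (baseEmb hn Mb) (stairContour hn Mb) (Ac j)
            *ᵥ (mulH (ι := ι) (hBox ((ℓ + 1) ^ k) K Mb j) *ᵥ Φ))) ≤ cK * supN Φ)
    (h3 : (3 : ℝ) ^ (d + 1) * (Real.sqrt (Fintype.card ι) * cK) ≤ Real.exp (-1))
    (x : ↥(Box d ℓ k Mb)) (P : ↥(Box d ℓ k Mb) → Prop) [DecidablePred P] {D : ℝ}
    (hD : ∀ x', P x' → ∃ μ, D ≤ |posR ℓ k Mb x μ - posR ℓ k Mb x' μ|)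
    (f : ↥(Box d ℓ k Mb) × ι → ℝ) (hfP : ∀ p, ¬ P p.1 → f p = 0) {φ : ℝ} (hφ : 0 ≤ φ) (hf : ∀ p, |f p| ≤ φ)
    (i : ι) :
    |(greenA d F κ ℓ k a m2 Mb (baseEmb hn Mb) (stairContour hn Mb) A *ᵥ f) (x, i)|
      ≤ 2 ^ (d + 2) * Real.exp (9 / 4) * (Real.sqrt (Fintype.card ι) * cG) * Real.exp (-(D / K)) * φ := by
  have hK1 : 1 ≤ K := le_trans (by norm_num) hK8
  have hKr : (0 : ℝ) < K := by exact_mod_cast hK1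
  have main := ineq110_value_apply (X := ↥(Box d ℓ k Mb)) (Y := ↥(boxDom Mb)) (κ := ι) hKr (posR ℓ k Mb)
    (boxWt ((ℓ + 1) ^ k) (fun i => (ℓ + 1) ^ k * Mb i)) m2
    (B1.aSeq a ((ℓ : ℝ) + 1) k * (((((ℓ + 1) ^ k : ℕ)) : ℝ) ^ (d + 1))⁻¹)
    (blkWt ((ℓ + 1) ^ k) Mb (fun i => (ℓ + 1) ^ k * Mb i)) (fieldLink F κ A)
    (contourTrans (fieldLink F κ A) (baseEmb hn Mb) (stairContour hn Mb))
    (fun _ _ h => boxWt_local hK8 h) (fun _ _ _ h h' => blkWt_local hK8 h h')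
    (labels Mb) (fun j z h => mem_labels_of_hCube_ne_zero hK1 j z h)
    (fun _ _ => True) (fun _ _ _ => trivial)
    (fun j => fieldLink F κ (Ac j))
    (fun j => contourTrans (fieldLink F κ (Ac j)) (baseEmb hn Mb) (stairContour hn Mb))
    (fun j u v hu hv => by
      show F.U (κ * Ac j u v) = F.U (κ * A u v)
      rw [hplat j u v hu hv])
    (fun j y u hq hu => contourTrans_plateau F κ h4 hn (hplat j) hu hq)
    (fun j => greenA d F κ ℓ k a m2 Mb (baseEmb hn Mb) (stairContour hn Mb) (Ac j))
    (fun j _ => by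
      simp only [iff_self, if_true]
      exact Matrix.mul_nonsing_inv _ (opA_stair_isUnit_det F κ hℓ hk hn ha hm Mb (Ac j)))
    (greenA d F κ ℓ k a m2 Mb (baseEmb hn Mb) (stairContour hn Mb) A)
    (Matrix.nonsing_inv_mul _ (opA_stair_isUnit_det F κ hℓ hk hn ha hm Mb A))
    (γ := Real.sqrt (Fintype.card ι) * cG) (β := Real.sqrt (Fintype.card ι) * cK)
    (by positivity) (fun j => linfty_opNorm_le_of_supN _ hcG (hG j.1 j.2)) (by positivity)
    (fun j => by
      simp only [iff_self, if_true]
      refine linfty_opNorm_le_of_supN _ hcK fun Φ => ?_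
      rw [← Matrix.mulVec_mulVec, ← Matrix.mulVec_mulVec]
      exact hKG j.1 j.2 Φ)
    h3 x P hD f hfP hφ hf i
  refine main.trans (le_of_eq ?_)
  ring

/-! ## 3. The print's cube configurations `Ã_j` (p35's `B4CubeFields22.cubeField`) -/

omit [Fintype ι] [DecidableEq ι] in
/-- the plateau in fine units: `|x/n − Kj|_∞ ≤ ¾K` iff `4|x − nKj| ≤ 3nK` (the form of `B4CubeFields22.cubeField_eq_compField`).
[cite: Balaban1983RegularityDecay, §2 p.575 «{x : |x − Mj| ≤ ¾M}»] -/
theorem plateau_fine {ℓ k : ℕ} {Mb : Fin (d + 1) → ℕ} {K : ℕ} {j : Fin (d + 1) → ℤ} {x : ↥(Box d ℓ k Mb)}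
    (hx : ∀ μ, |posR ℓ k Mb x μ - (K : ℝ) * j μ| ≤ 3 / 4 * (K : ℝ)) (μ : Fin (d + 1)) :
    4 * |((x.1 μ : ℤ) : ℝ) - ((((ℓ + 1) ^ k : ℕ)) : ℝ) * K * j μ| ≤ 3 * (((((ℓ + 1) ^ k : ℕ)) : ℝ) * K) := by
  have hn : (0 : ℝ) < ((((ℓ + 1) ^ k : ℕ)) : ℝ) := by exact_mod_cast pow_pos (Nat.succ_pos ℓ) k
  have h := hx μ
  rw [posR] at h
  have e : ((x.1 μ : ℤ) : ℝ) - ((((ℓ + 1) ^ k : ℕ)) : ℝ) * K * j μ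
      = ((((ℓ + 1) ^ k : ℕ)) : ℝ) * (((x.1 μ : ℤ) : ℝ) / ((((ℓ + 1) ^ k : ℕ)) : ℝ) - (K : ℝ) * j μ) := by
    field_simp
  rw [e, abs_mul, abs_of_pos hn]
  nlinarith

/-- **THEOREM (1.10) ON A BOX FOR THE COMPONENT FIELD `A` AND THE PRINT'S `Ã_j = A₀ + θ_j(A − A₀)`** (value member):
`thm110_value_box` with `A := compField Ac` on `Ω` and `Ã_j := B4CubeFields22.cubeField Ω n K j (Ac 0) Ac` for EVERY
label; the plateau agreement «A_j = A on {θ_j = 1}» is p35's `cubeField_eq_compField`, so the only remaining inputs are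
the per-cube bounds `‖G_k(Ω,Ã_j)Φ‖_∞ ≤ c_G‖Φ‖_∞`, `‖K_{h_j}G_k(Ω,Ã_j)h_jΦ‖_∞ ≤ c_K‖Φ‖_∞` — proved by
`B4Eq220CubeField.lemma22_sup_cubeField` / `eq220_cubeField` at the interior cubes for a (1.7)-regular `A` — and the
smallness `3^{d+1}√N c_K ≤ e^{−1}`. [cite: Balaban1983RegularityDecay, Theorem (1.10) p.573; §2 pp.575–579] -/
theorem thm110_value_box_cubeField (F : OrthFlow ι) {ℓ k : ℕ} (hℓ : 1 ≤ ℓ) (hk : 1 ≤ k) (hn : 1 ≤ (ℓ + 1) ^ k)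
    (Mb : Fin (d + 1) → ℕ) {K : ℕ} (hK8 : 8 ≤ K) (h4 : 4 ∣ K) {a m2 : ℝ} (ha : 0 < a) (hm : 0 ≤ m2) (e : ℝ)
    (Ac : (Fin (d + 1) → ℤ) → Fin (d + 1) → ℝ) {cG cK : ℝ} (hcG : 0 ≤ cG) (hcK : 0 ≤ cK)
    (hG : ∀ j ∈ labels Mb, ∀ Φ : ↥(Box d ℓ k Mb) × ι → ℝ,
      supN (greenA d F (e / ((ℓ + 1) ^ k : ℕ)) ℓ k a m2 Mb (baseEmb hn Mb) (stairContour hn Mb)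
          (cubeField (Box d ℓ k Mb) ((ℓ + 1) ^ k) K j (Ac 0) Ac) *ᵥ Φ) ≤ cG * supN Φ)
    (hKG : ∀ j ∈ labels Mb, ∀ Φ : ↥(Box d ℓ k Mb) × ι → ℝ,
      supN (kOp F (e / ((ℓ + 1) ^ k : ℕ)) ((ℓ + 1) ^ k) (B1.aSeq a ((ℓ : ℝ) + 1) k) m2 Mb (baseEmb hn Mb)
            (stairContour hn Mb) (cubeField (Box d ℓ k Mb) ((ℓ + 1) ^ k) K j (Ac 0) Ac) (hBox ((ℓ + 1) ^ k) K Mb j)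
          *ᵥ (greenA d F (e / ((ℓ + 1) ^ k : ℕ)) ℓ k a m2 Mb (baseEmb hn Mb) (stairContour hn Mb)
              (cubeField (Box d ℓ k Mb) ((ℓ + 1) ^ k) K j (Ac 0) Ac)
            *ᵥ (mulH (ι := ι) (hBox ((ℓ + 1) ^ k) K Mb j) *ᵥ Φ))) ≤ cK * supN Φ)
    (h3 : (3 : ℝ) ^ (d + 1) * (Real.sqrt (Fintype.card ι) * cK) ≤ Real.exp (-1))
    (x : ↥(Box d ℓ k Mb)) (P : ↥(Box d ℓ k Mb) → Prop) [DecidablePred P] {D : ℝ}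
    (hD : ∀ x', P x' → ∃ μ, D ≤ |posR ℓ k Mb x μ - posR ℓ k Mb x' μ|)
    (f : ↥(Box d ℓ k Mb) × ι → ℝ) (hfP : ∀ p, ¬ P p.1 → f p = 0) {φ : ℝ} (hφ : 0 ≤ φ) (hf : ∀ p, |f p| ≤ φ)
    (i : ι) :
    |(greenA d F (e / ((ℓ + 1) ^ k : ℕ)) ℓ k a m2 Mb (baseEmb hn Mb) (stairContour hn Mb)
        (fun u v : ↥(Box d ℓ k Mb) => compField Ac u.1 v.1) *ᵥ f) (x, i)|
      ≤ 2 ^ (d + 2) * Real.exp (9 / 4) * (Real.sqrt (Fintype.card ι) * cG) * Real.exp (-(D / K)) * φ := by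
  have hK1 : 1 ≤ K := le_trans (by norm_num) hK8
  exact thm110_value_box F (e / ((ℓ + 1) ^ k : ℕ)) hℓ hk hn Mb hK8 h4 ha hm
    (fun u v : ↥(Box d ℓ k Mb) => compField Ac u.1 v.1)
    (fun j => cubeField (Box d ℓ k Mb) ((ℓ + 1) ^ k) K j (Ac 0) Ac)
    (fun j u v hu hv => cubeField_eq_compField hn hK1 j (Ac 0) Ac (fun μ => plateau_fine hu μ)
      (fun μ => plateau_fine hv μ))
    hcG hcK hG hKG h3 x P hD f hfP hφ hf i

end

end Literature.MathematicalPhysics.QuantumFieldTheory.Balaban1983to89.B4Thm110BoxWalk
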